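import Literature.MathematicalPhysics.QuantumFieldTheory.Balaban1983to89.B9Thm39WholeBlk

/-!
# `Balaban1983to89.B9Thm39WholeBlkFaces` — [B9] Theorem 3.9 (p. 413) and «This theorem implies Theorem 3.2» OVER AN ABSTRACT CARRIER `X`
# WITH A BLOCK MAP (sequel of `B9Thm39WholeBlk`): the family-level printed leaves at the pinned carrier datum `EK39OfOpsBlk`, the faces at the
# DEFINITE (2.61) constant `rowConst261` (no Lemma-2.1 binder), the face at def-Y's operator-layer signature (rows 15 ∧ 16 of the N06 knit from a
# LITERAL pin), and the bookkeeping «the scalar face is the case X = 𝔅, blk = id»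

T. Bałaban, *Propagators for lattice gauge theories in a background field*, Commun. Math. Phys. **99** (1985) 389–434
[`Balaban1985BackgroundPropagators`, "B9"]; [4] = T. Bałaban, *Propagators and renormalization transformations for lattice gauge
theories. II*, Commun. Math. Phys. **96** (1984) 223–250 [`Balaban1984PropagatorsII`].

statement-level skeleton of published theorems with citation tags; proofs where landed; nothing here is a claim about the
Yang–Mills mass gap

THE PRINTED LOCI (verbatim).  [B9] p. 413, Theorem 3.9: *"For M sufficiently large, and a configuration U satisfying (3.35), the operator Q′G′²Q′\*
has an inverse which can be represented as (Q′G′²Q′\*)⁻¹ = Σ_ω R′₀(X₀)R′_{α₁}(X₁)·⋯·R′_{αₙ}(Xₙ) (3.98) … A term in this expansion corresponding to a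
walk ω depends on U restructed [sic] to X̃⁵₀ ∪ X̃⁵₁ ∪ … ∪ X̃⁵ₙ, and has the following bound: |(R′₀(X₀)R′_{α₁}(X₁)·⋯·R′_{αₙ}(Xₙ))(y, y′)| ≦ O(1)(L^jη)^{−4}
(L^{j′}η)^{−d}O(M^{−1/2})^{|ω|}M^{−½|ω|}e^{−½δ₀d(ω,y,y′)}, y ∈ Λ_j, y′ ∈ Λ_{j′} (3.99) … This theorem implies Theorem 3.2."*;  [4] p. 234: *"sup_{y∈𝔅}
Σ_{y′∈𝔅} e^{−αδ₀d(y,y′)} ≤ c₁(α), (2.61)"* for *"RM satisfying (2.59)"*.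

WHY THIS FILE.  `B9Thm39WholeBlk` re-types the Theorem-3.9 letters over an abstract carrier `X` fibred over 𝔅 by `blk` ([4]'s (2.51) currency), so that
𝔤-valued block functions are admitted and the carrier-kernel reading is the dischargeable MAJORIZATION `KerReadsLe … cR`; it proves the one-member,
one-U content ((3.96) ⇒ (3.48), (3.99), the localisation clause).  THIS FILE assembles, exactly as the scalar lineage `B9Thm39Whole` §4–§6 ∕
`B9Thm39WholeGeneric` §3b ∕ `B9RowSum261DefiniteFaces` §3–§4 does:
* §1 ★ `thm39Printed_of_local348Blk` — the whole printed leaf `B9.Thm39Printed d c35 geo bg (fun i => EK39OfOpsBlk (𝔬 i) (rd i) d (2NB₀c′) ((1 − α′)r))`,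
  (2.61) in the generic-constant form at both rates (M₂ := max(M₁, M_L, 2θ₀c′), a₀ := a₁∕c35, rate 2(1 − α)δ₀, O(1) := B₀, O(M^{−1/2}) := (θ₀c + 1)M^{−1/2}).
* §2 `rwKernelSumYields_of_conv348Blk`, ★ `rwKernelSumYields_EK39OfOpsBlk` (constant max(cR·B₁, 1)), `thm32Printed_EK39OfOpsBlk`.
* §3 bookkeeping: `Ops39.toBlk`, `blockKer_id`, `conv348Blk_of_conv348`, `kerReadsLe_of_kerReads` — the landed scalar face IS the case X = 𝔅, blk = id, cR = 1.
* §4 at the DEFINITE constant `B9RowSum261DefiniteFaces.rowConst261` fed by the family schema `RowSum261 geo`: ★ `thm39Printed_rowConst261Blk_of_rowSum261`,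
  ★★ `thm39_and_kernelSum_rowConst261Blk_of_rowSum261`, `thm39_and_kernelSum_of_pin_rowConst261Blk`, `thm32Printed_of_pin_rowConst261Blk`.
* §5 at def-Y's operator-layer signature `ops : ∀ x, OperatorLayerY … x`: ★★ `t39_hksum_of_pin_rowConst261Blk` — rows 15 ∧ 16 from the LITERAL pin
  `(ops x).EK39 = EK39OfOpsBlk (𝔬39 x) (rd39 x) dd (2(N·B₀)·rowConst261 geo9Y (α′r)) ((1−α′)r)` and `KerReadsLe (𝔬39 x) (ops x).Cinv dd cR`, ZERO (2.61) binders
  (n06-i's `rowSum261_geo9Y` by name); `thm39_and_kernelSum_geo9Y_blk`.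

HONEST SCOPE.  Kernel bookkeeping over `B9Thm39WholeBlk`; every Theorem-3.9 schema (`StaticOK39Blk`, `Locality39Blk`, `Local348Blk`, `Identities395Blk`,
`Small285Blk`, `Factors389Blk`) and the reading `KerReadsLe` stay DISPLAYED; nothing of [B9] or [4] asserted; NOT a node discharge; count-neutral; one
finite 𝕋⁴ programme — nothing continuum, nothing about the mass gap.  Cell `pub-ymgap` (HUMAN RULING D-0062), Track A node N06 [B9], seat
`pub-ymgap-dag-n06-j` (harness re-seat gen 4), 2026-08-27.
-/

namespace Literature.MathematicalPhysics.QuantumFieldTheory.Balaban1983to89.B9Thm39WholeBlkFaces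

open Literature.MathematicalPhysics.QuantumFieldTheory.Balaban1983to89
open Finset B6RandomWalk B9Thm37Sum B9Thm34Ext B9Thm34Inv B9Thm39Sum B9Cor38Whole B9Thm39Whole B9Thm39WholeGeneric
open B6Lemma21Repaired B9Thm39WholeBlk

noncomputable section

/-! ## §1 The whole printed leaf at the pinned datum over the carrier -/

section Family

variable {I : Type} {c35 : ℝ} {geo : I → B9.Geometry} {bg : I → B9.Backgrounds}
variable [∀ i, Fintype (geo i).Site] [∀ i, DecidableEq (geo i).Site]
variable {X ι κ : I → Type} [∀ i, Fintype (ι i)] [∀ i, Fintype (X i)] [∀ i, DecidableEq (X i)]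

/-- ★ **THEOREM 3.9 AS THE WHOLE PRINTED LEAF `B9.Thm39Printed` OVER THE CARRIER, (2.61) WITH GENERIC CONSTANTS** (p. 413: *"For M
sufficiently large, and a configuration U satisfying (3.35), the operator Q′G′²Q′\* has an inverse which can be represented as (Q′G′²Q′\*)⁻¹ =
Σ_ω R′₀(X₀)R′_{α₁}(X₁)·⋯·R′_{αₙ}(Xₙ) (3.98) … (3.99)"*), INHABITED at the pinned datum `EK39OfOpsBlk (𝔬 i) (rd i) d (2NB₀c′) ((1 − α′)r)` — the carrier
twin of `B9Thm39WholeGeneric.thm39Printed_of_local348With`, same constants and thresholds (M₂ := max(M₁, M_L, 2θ₀c′), a₀ := a₁∕c35, rate 2(1 − α)δ₀,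
O(1) := B₀, O(M^{−1/2}) := (θ₀c + 1)M^{−1/2}); inputs `StaticOK39Blk`, `Locality39Blk`, (2.61) at (δ₀, α) with constant c and at (r, α′) with
constant c′ for M ≧ M_L, and per U under the provisos `Local348Blk ∧ Identities395Blk ∧ Small285Blk ∧ Factors389Blk`.  Nothing of print asserted;
NOT a node discharge. [cite: Balaban1985BackgroundPropagators, Thm 3.9 (3.98)–(3.99) p.413 + (3.95)–(3.96) p.411 + (3.35) p.396; Balaban1984PropagatorsII, Lemma 2.1 (2.61) p.234 + (2.83)–(2.87) p.238] -/
theorem thm39Printed_of_local348Blk (𝔬 : ∀ i, Ops39Blk (geo i) (bg i) (X i) (ι i) (κ i))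
    (rd : ∀ i, WalkReading39 (bg i) (ι i) (κ i)) (c c' : ℝ) (d : ℕ) (α α' r δ₀ θ₀ B₀ N a₁ M₁ ML : ℝ)
    (hc : 0 ≤ c) (hc' : 0 ≤ c') (h35 : 0 < c35) (hα : 0 ≤ α) (hα1 : α < 1) (hα' : α' ≤ 1) (hr : 0 ≤ r) (hrδ : r ≤ δ₀)
    (hδ₀ : 0 < δ₀) (hθ₀ : 0 ≤ θ₀) (hB₀ : 0 < B₀) (hN : 0 ≤ N) (ha₁ : 0 < a₁) (hM₁ : 0 < M₁)
    (hst : ∀ i, StaticOK39Blk (𝔬 i) N) (hloc : ∀ i, Locality39Blk (𝔬 i) (rd i))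
    (h261 : ∀ i, ML ≤ (geo i).M → Ineq261With c (b6 (geo i)) δ₀ α ∧ Ineq261With c' (b6 (geo i)) r α')
    (h39 : ∀ i, M₁ ≤ (geo i).M → ∀ α₀ : ℝ, 0 < α₀ → c35 * (geo i).M * α₀ ≤ a₁ →
      ∀ U : (bg i).Cfg, (bg i).Reg335 c35 α₀ U →
        Local348Blk (𝔬 i) B₀ δ₀ U ∧ Identities395Blk (𝔬 i) U ∧ Small285Blk (𝔬 i) θ₀ r U ∧ Factors389Blk (𝔬 i) θ₀ δ₀ U) :
    B9.Thm39Printed d c35 geo bg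
      (fun i => EK39OfOpsBlk (𝔬 i) (rd i) d (2 * (N * B₀) * c') ((1 - α') * r)) := by
  have hcpos : 0 < θ₀ * c + 1 := by
    have h0 : 0 ≤ θ₀ * c := mul_nonneg hθ₀ hc
    linarith
  refine ⟨max M₁ (max ML (2 * θ₀ * c')), a₁ / c35, 2 * ((1 - α) * δ₀), B₀, θ₀ * c + 1,
    lt_max_of_lt_left hM₁, div_pos ha₁ h35, by nlinarith, hB₀, hcpos, ?_⟩
  intro i hM α₀ hα₀ hMa U hU
  have hM₁i : M₁ ≤ (geo i).M := le_trans (le_max_left _ _) hM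
  have hMLi : ML ≤ (geo i).M := le_trans (le_trans (le_max_left _ _) (le_max_right _ _)) hM
  have hbig : 2 * θ₀ * c' ≤ (geo i).M := le_trans (le_trans (le_max_right _ _) (le_max_right _ _)) hM
  have hMpos : 0 < (geo i).M := lt_of_lt_of_le hM₁ hM₁i
  have ha : c35 * (geo i).M * α₀ ≤ a₁ := by
    have h1 : (geo i).M * α₀ * c35 ≤ a₁ := (le_div_iff₀ h35).mp hMa
    calc c35 * (geo i).M * α₀ = (geo i).M * α₀ * c35 := by ring
      _ ≤ a₁ := h1
  obtain ⟨hl, hi, hR, hf⟩ := h39 i hM₁i α₀ hα₀ ha U hU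
  obtain ⟨h261a, h261b⟩ := h261 i hMLi
  refine ⟨?_, fun w y y' => ⟨locDep_EK39OfOpsBlk (𝔬 i) (rd i) d _ _ (hloc i) U w, ?_⟩⟩
  · exact conv348Blk_of_local348 (𝔬 i) c' r α' θ₀ B₀ δ₀ N U hc' hr hrδ hα' hθ₀ hB₀.le hN hMpos hbig (hst i) h261b hl hi hR
  · exact kterm_EK39OfOpsBlk_le (𝔬 i) (rd i) c d _ _ δ₀ α θ₀ B₀ N U hc hδ₀.le hα hα1.le hθ₀ hB₀.le hMpos (hst i) h261a
      hl hf w y y'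

end Family

/-! ## §2 «This theorem implies Theorem 3.2» — the kernel-summation leaf at the datum, the reading as a majorization -/

section FamilyKernelSum

variable {I : Type} {c35 : ℝ} {geo : I → B9.Geometry} {bg : I → B9.Backgrounds}
variable [∀ i, Fintype (geo i).Site] [∀ i, DecidableEq (geo i).Site]
variable {X ι κ : I → Type} [∀ i, Fintype (ι i)] [∀ i, Fintype (X i)] [∀ i, DecidableEq (X i)]

omit [∀ i, Fintype (ι i)] in
/-- **«THIS THEOREM IMPLIES THEOREM 3.2» over the carrier**: for ANY expansion data `E` whose convergence predicate implies `Conv348Blk (𝔬 i) B₁ δ₁`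
(B₁ ≧ 0, δ₁ > 0) and any carrier kernel `Cinv` DOMINATED by the inverse (`KerReadsLe … cR`, cR ≧ 0): `B9.RWKernelSumYields d geo bg E Cinv` with the
constant max(cR·B₁, 1) — the inverse's majorant bounds its block norm (`blockKer_le_of_hasMajorant`), the reading supplies (L^{j′}η)^{−d} (`vol_inv`,
L^jη > 0). [cite: Balaban1985BackgroundPropagators, Thm 3.9 ⇒ Thm 3.2 p.413 + (3.48) p.398] -/
theorem rwKernelSumYields_of_conv348Blk {E : ∀ i, B9.RWKernelExpansion (geo i) (bg i)}
    (𝔬 : ∀ i, Ops39Blk (geo i) (bg i) (X i) (ι i) (κ i)) (Cinv : ∀ i, B9.SiteKernel (geo i) (bg i)) (d : ℕ) {B₁ δ₁ cR : ℝ}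
    (hB₁ : 0 ≤ B₁) (hδ₁ : 0 < δ₁) (hcR : 0 ≤ cR) (hlen : ∀ (i : I) (y : (geo i).Site), 0 < (geo i).len y)
    (hE : ∀ (i : I) (U : (bg i).Cfg), (E i).Converges U → Conv348Blk (𝔬 i) B₁ δ₁ U)
    (hrd : ∀ i, KerReadsLe (𝔬 i) (Cinv i) d cR) : B9.RWKernelSumYields d geo bg E Cinv := by
  refine ⟨max (cR * B₁) 1, δ₁, lt_max_of_lt_right one_pos, hδ₁, fun i U hconv y y' => ?_⟩
  obtain ⟨T, hTL, hLT, hmaj⟩ := hE i U hconv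
  have hvol := vol_pos d (hlen i)
  have hK : 0 ≤ B₁ * (geo i).len y ^ (-(4 : ℝ)) * Real.exp (-(δ₁ * (geo i).dist y y')) :=
    mul_nonneg (mul_nonneg hB₁ (Real.rpow_nonneg (hlen i y).le _)) (Real.exp_nonneg _)
  have hbk := blockKer_le_of_hasMajorant (𝔬 i).blk hmaj (y := y) (y' := y') hK
  have hrest : 0 ≤ (geo i).len y ^ (-(4 : ℝ)) * (geo i).len y' ^ (-(d : ℝ)) * Real.exp (-(δ₁ * (geo i).dist y y')) :=
    mul_nonneg (mul_nonneg (Real.rpow_nonneg (hlen i y).le _) (Real.rpow_nonneg (hlen i y').le _)) (Real.exp_nonneg _)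
  calc |(Cinv i).ker U y y'| ≤ cR * (vol (geo i) d y')⁻¹ * blockKer (𝔬 i).blk T y y' := hrd i U T hTL hLT y y'
    _ ≤ cR * (vol (geo i) d y')⁻¹ * (B₁ * (geo i).len y ^ (-(4 : ℝ)) * Real.exp (-(δ₁ * (geo i).dist y y'))) :=
        mul_le_mul_of_nonneg_left hbk (mul_nonneg hcR (inv_nonneg.mpr (hvol y').le))
    _ = cR * B₁ * ((geo i).len y ^ (-(4 : ℝ)) * (geo i).len y' ^ (-(d : ℝ)) * Real.exp (-(δ₁ * (geo i).dist y y'))) := by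
        rw [vol_inv d (hlen i) y']
        ring
    _ ≤ max (cR * B₁) 1 * ((geo i).len y ^ (-(4 : ℝ)) * (geo i).len y' ^ (-(d : ℝ)) * Real.exp (-(δ₁ * (geo i).dist y y'))) :=
        mul_le_mul_of_nonneg_right (le_max_left _ _) hrest
    _ = _ := by ring

omit [∀ i, Fintype (ι i)] in
/-- ★ **`hksum` AT THE PINNED CARRIER DATUM**: `B9.RWKernelSumYields d geo bg (fun i => EK39OfOpsBlk (𝔬 i) (rd i) d B₁ δ₁) Cinv` for every carrier kernel
dominated by the inverse (`KerReadsLe`), B₁ ≧ 0, δ₁ > 0, cR ≧ 0, L^jη > 0 (`converges_EK39OfOpsBlk` is `Iff.rfl`). [cite: Balaban1985BackgroundPropagators, Thm 3.9 ⇒ Thm 3.2 p.413 + (3.48) p.398] -/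
theorem rwKernelSumYields_EK39OfOpsBlk (𝔬 : ∀ i, Ops39Blk (geo i) (bg i) (X i) (ι i) (κ i))
    (rd : ∀ i, WalkReading39 (bg i) (ι i) (κ i)) (Cinv : ∀ i, B9.SiteKernel (geo i) (bg i)) (d : ℕ) {B₁ δ₁ cR : ℝ}
    (hB₁ : 0 ≤ B₁) (hδ₁ : 0 < δ₁) (hcR : 0 ≤ cR) (hlen : ∀ (i : I) (y : (geo i).Site), 0 < (geo i).len y)
    (hrd : ∀ i, KerReadsLe (𝔬 i) (Cinv i) d cR) :
    B9.RWKernelSumYields d geo bg (fun i => EK39OfOpsBlk (𝔬 i) (rd i) d B₁ δ₁) Cinv :=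
  rwKernelSumYields_of_conv348Blk 𝔬 Cinv d hB₁ hδ₁ hcR hlen (fun _ _ h => h) hrd

omit [∀ i, Fintype (ι i)] in
/-- **THEOREM 3.2 AS TYPED from the two leaves at the carrier datum** (p. 413: *"This theorem implies Theorem 3.2"*, the cell's `B9.thm32_of_thm39`).
[cite: Balaban1985BackgroundPropagators, Thm 3.9 ⇒ Thm 3.2 p.413 + Thm 3.2 (3.48) p.398] -/
theorem thm32Printed_EK39OfOpsBlk (𝔬 : ∀ i, Ops39Blk (geo i) (bg i) (X i) (ι i) (κ i))
    (rd : ∀ i, WalkReading39 (bg i) (ι i) (κ i)) (Cinv : ∀ i, B9.SiteKernel (geo i) (bg i)) (d : ℕ) {B₁ δ₁ cR : ℝ}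
    (hB₁ : 0 ≤ B₁) (hδ₁ : 0 < δ₁) (hcR : 0 ≤ cR) (hlen : ∀ (i : I) (y : (geo i).Site), 0 < (geo i).len y)
    (hrd : ∀ i, KerReadsLe (𝔬 i) (Cinv i) d cR)
    (h39 : B9.Thm39Printed d c35 geo bg (fun i => EK39OfOpsBlk (𝔬 i) (rd i) d B₁ δ₁)) :
    B9.Thm32Printed d c35 geo bg Cinv :=
  B9.thm32_of_thm39 d c35 geo bg _ Cinv h39 (rwKernelSumYields_EK39OfOpsBlk 𝔬 rd Cinv d hB₁ hδ₁ hcR hlen hrd)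

end FamilyKernelSum

/-! ## §3 Bookkeeping: the scalar face IS the case X = 𝔅, blk = id -/

section Scalar

variable {g : B9.Geometry} [Fintype g.Site] [DecidableEq g.Site] {B : B9.Backgrounds} {ι κ : Type}

omit [Fintype g.Site] [DecidableEq g.Site] in
/-- The scalar letters `B9Thm39Whole.Ops39` (functions on 𝔅) ARE carrier letters with X = 𝔅 and the identity block map.
[cite: Balaban1985BackgroundPropagators, (3.87) p.409 (bookkeeping)] -/
def _root_.Literature.MathematicalPhysics.QuantumFieldTheory.Balaban1983to89.B9Thm39Whole.Ops39.toBlk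
    (𝔬 : Ops39 g B ι κ) : Ops39Blk g B g.Site ι κ where
  blk := fun y => y
  S := 𝔬.S
  h := 𝔬.h
  chi := 𝔬.chi
  L := 𝔬.L
  Lloc := 𝔬.Lloc
  Cl := 𝔬.Cl
  Sw := 𝔬.Sw
  Rw := 𝔬.Rw

/-- On the scalar carrier (X = 𝔅, blk = id) the block norm IS the absolute entry |T(δ_{y′})(y)| (bookkeeping: the scalar kernel reading of (3.48)). [cite: Balaban1985BackgroundPropagators, (3.48) p.398 (bookkeeping)] -/
theorem blockKer_id (T : Module.End ℝ (g.Site → ℝ)) (y y' : g.Site) :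
    blockKer (fun x : g.Site => x) T y y' = |entry T y y'| := by
  unfold blockKer
  have hsum : ∀ x : {x : g.Site // x = y}, (∑ x' ∈ univ.filter (fun x' => x' = y'), |entry T x.1 x'|) = |entry T y y'| := by
    intro x
    rw [Finset.filter_eq' univ y', if_pos (mem_univ _), sum_singleton, x.2]
  simp_rw [hsum]
  haveI : Nonempty {x : g.Site // x = y} := ⟨⟨y, rfl⟩⟩
  exact ciSup_const

/-- **The scalar convergence content implies the carrier one** at X = 𝔅, blk = id: the printed kernel bound |T(y, y′)| ≦ B₁(L^jη)^{−4}(L^{j′}η)^{−d}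
e^{−δ₁d} (kernel w.r.t. (L^{j′}η)^d, `B9Thm39Whole.Conv348`) IS the (2.51)-majorant B₁(L^jη)^{−4}e^{−δ₁d} (`B9Thm34Inv.ker_le_iff`, `hasMajorant_id_iff`).
[cite: Balaban1985BackgroundPropagators, (3.96) p.411 + (3.48) p.398; Balaban1984PropagatorsII, (2.51) p.232 + (2.86) p.238] -/
theorem conv348Blk_of_conv348 (𝔬 : Ops39 g B ι κ) (d : ℕ) {B₁ δ₁ : ℝ} (U : B.Cfg) (hlen : ∀ y : g.Site, 0 < g.len y)
    (h : Conv348 𝔬 d B₁ δ₁ U) : Conv348Blk 𝔬.toBlk B₁ δ₁ U := by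
  obtain ⟨T, hTL, hLT, hb⟩ := h
  refine ⟨T, hTL, hLT, ?_⟩
  refine (hasMajorant_id_iff (R := 0) (H := True) T _).mpr fun y y' => ?_
  refine (ker_le_iff (vol g d) (vol_pos d hlen y') T y _).mp ?_
  refine (hb y y').trans (le_of_eq ?_)
  rw [vol_inv d hlen y']
  ring

/-- **The scalar reading implies the carrier one** at X = 𝔅, blk = id, with cR = 1: `KerReads` (equality with the kernel w.r.t. (L^{j′}η)^d) gives
`KerReadsLe … 1` (`blockKer_id`). [cite: Balaban1985BackgroundPropagators, Thm 3.2 (3.48) p.398 (bookkeeping)] -/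
theorem kerReadsLe_of_kerReads (𝔬 : Ops39 g B ι κ) (Cv : B9.SiteKernel g B) (d : ℕ) (hlen : ∀ y : g.Site, 0 < g.len y)
    (h : KerReads 𝔬 Cv d) : KerReadsLe 𝔬.toBlk Cv d 1 := by
  intro U T hTL hLT y y'
  rw [h U T hTL hLT y y', one_mul]
  show |ker (vol g d) T y y'| ≤ (vol g d y')⁻¹ * blockKer (fun x : g.Site => x) T y y'
  rw [blockKer_id, ker, abs_div, abs_of_pos (vol_pos d hlen y'), div_eq_inv_mul]

end Scalar

/-! ## §4 Rows 15–16 over the carrier at the DEFINITE (2.61) constant `rowConst261` — no (2.61) hypothesis, no existential -/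

section Rows1516

variable {I : Type} {c35 : ℝ} {geo : I → B9.Geometry} {bg : I → B9.Backgrounds}
variable [∀ i, Fintype (geo i).Site] [∀ i, DecidableEq (geo i).Site]
variable {X ι κ : I → Type} [∀ i, Fintype (ι i)] [∀ i, Fintype (X i)] [∀ i, DecidableEq (X i)]

/-- ★ **THEOREM 3.9 OVER THE CARRIER AT THE DEFINITE DATUM** `EK39OfOpsBlk (𝔬 i) (rd i) d (2NB₀·rowConst261 geo (α′r)) ((1 − α′)r)`, [4] Lemma 2.1 (2.61)
SUPPLIED BY THE FAMILY SCHEMA `RowSum261 geo` at both rates (the carrier twin of `B9RowSum261DefiniteFaces.thm39Printed_rowConst261_of_rowSum261`).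
[cite: Balaban1985BackgroundPropagators, Thm 3.9 (3.98)–(3.99) p.413 + (3.35) p.396; Balaban1984PropagatorsII, Lemma 2.1 (2.61) p.234] -/
theorem thm39Printed_rowConst261Blk_of_rowSum261 (𝔬 : ∀ i, Ops39Blk (geo i) (bg i) (X i) (ι i) (κ i))
    (rd : ∀ i, WalkReading39 (bg i) (ι i) (κ i)) (d : ℕ) (α α' r δ₀ θ₀ B₀ N a₁ M₁ : ℝ)
    (h35 : 0 < c35) (hα : 0 < α) (hα1 : α < 1) (hα'0 : 0 < α') (hα' : α' ≤ 1) (hr : 0 < r) (hrδ : r ≤ δ₀)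
    (hθ₀ : 0 ≤ θ₀) (hB₀ : 0 < B₀) (hN : 0 ≤ N) (ha₁ : 0 < a₁) (hM₁ : 0 < M₁)
    (hst : ∀ i, StaticOK39Blk (𝔬 i) N) (hloc : ∀ i, Locality39Blk (𝔬 i) (rd i)) (hrow : B9Ineq349Whole.RowSum261 geo)
    (h39 : ∀ i, M₁ ≤ (geo i).M → ∀ α₀ : ℝ, 0 < α₀ → c35 * (geo i).M * α₀ ≤ a₁ →
      ∀ U : (bg i).Cfg, (bg i).Reg335 c35 α₀ U →
        Local348Blk (𝔬 i) B₀ δ₀ U ∧ Identities395Blk (𝔬 i) U ∧ Small285Blk (𝔬 i) θ₀ r U ∧ Factors389Blk (𝔬 i) θ₀ δ₀ U) :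
    B9.Thm39Printed d c35 geo bg
      (fun i => EK39OfOpsBlk (𝔬 i) (rd i) d (2 * (N * B₀) * B9RowSum261DefiniteFaces.rowConst261 geo (α' * r))
        ((1 - α') * r)) := by
  have hδ₀ : 0 < δ₀ := lt_of_lt_of_le hr hrδ
  obtain ⟨ML, h261⟩ := B9RowSum261DefiniteFaces.ineq261With_pair_rowConst261_of_rowSum261 (geo := geo) (fun _ => (0 : ℝ))
    (fun _ => True) (mul_pos hα hδ₀) (mul_pos hα'0 hr) hrow
  exact thm39Printed_of_local348Blk 𝔬 rd (B9RowSum261DefiniteFaces.rowConst261 geo (α * δ₀))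
    (B9RowSum261DefiniteFaces.rowConst261 geo (α' * r)) d α α' r δ₀ θ₀ B₀ N a₁ M₁ ML
    (B9RowSum261DefiniteFaces.rowConst261_nonneg geo _) (B9RowSum261DefiniteFaces.rowConst261_nonneg geo _) h35 hα.le hα1
    hα' hr.le hrδ hδ₀ hθ₀ hB₀ hN ha₁ hM₁ hst hloc h261 h39

/-- ★★ **ROWS 15 AND 16 OVER THE CARRIER AT THE DEFINITE DATUM FROM `RowSum261`**: Theorem 3.9 as the whole printed leaf AND the kernel-summation leaf
at the SAME datum, for every carrier kernel DOMINATED by the inverse (`KerReadsLe … cR`, cR ≧ 0).  NO existential, NO (2.61) hypothesis: the knit may pin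
`(ops x).EK39` LITERALLY to this datum. [cite: Balaban1985BackgroundPropagators, Thm 3.9 p.413 («This theorem implies Theorem 3.2») + Thm 3.2 (3.48) p.398; Balaban1984PropagatorsII, Lemma 2.1 (2.61) p.234] -/
theorem thm39_and_kernelSum_rowConst261Blk_of_rowSum261 (𝔬 : ∀ i, Ops39Blk (geo i) (bg i) (X i) (ι i) (κ i))
    (rd : ∀ i, WalkReading39 (bg i) (ι i) (κ i)) (Cinv : ∀ i, B9.SiteKernel (geo i) (bg i)) (d : ℕ)
    (α α' r δ₀ θ₀ B₀ N a₁ M₁ cR : ℝ)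
    (h35 : 0 < c35) (hα : 0 < α) (hα1 : α < 1) (hα'0 : 0 < α') (hα'1 : α' < 1) (hr : 0 < r) (hrδ : r ≤ δ₀)
    (hθ₀ : 0 ≤ θ₀) (hB₀ : 0 < B₀) (hN : 0 ≤ N) (ha₁ : 0 < a₁) (hM₁ : 0 < M₁) (hcR : 0 ≤ cR)
    (hst : ∀ i, StaticOK39Blk (𝔬 i) N) (hloc : ∀ i, Locality39Blk (𝔬 i) (rd i)) (hrow : B9Ineq349Whole.RowSum261 geo)
    (hrd : ∀ i, KerReadsLe (𝔬 i) (Cinv i) d cR)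
    (h39 : ∀ i, M₁ ≤ (geo i).M → ∀ α₀ : ℝ, 0 < α₀ → c35 * (geo i).M * α₀ ≤ a₁ →
      ∀ U : (bg i).Cfg, (bg i).Reg335 c35 α₀ U →
        Local348Blk (𝔬 i) B₀ δ₀ U ∧ Identities395Blk (𝔬 i) U ∧ Small285Blk (𝔬 i) θ₀ r U ∧ Factors389Blk (𝔬 i) θ₀ δ₀ U) :
    B9.Thm39Printed d c35 geo bg
        (fun i => EK39OfOpsBlk (𝔬 i) (rd i) d (2 * (N * B₀) * B9RowSum261DefiniteFaces.rowConst261 geo (α' * r))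
          ((1 - α') * r)) ∧
      B9.RWKernelSumYields d geo bg
        (fun i => EK39OfOpsBlk (𝔬 i) (rd i) d (2 * (N * B₀) * B9RowSum261DefiniteFaces.rowConst261 geo (α' * r))
          ((1 - α') * r)) Cinv := by
  have hδ₁ : 0 < (1 - α') * r := mul_pos (by linarith) hr
  have hB₁ : 0 ≤ 2 * (N * B₀) * B9RowSum261DefiniteFaces.rowConst261 geo (α' * r) :=
    mul_nonneg (mul_nonneg zero_le_two (mul_nonneg hN hB₀.le)) (B9RowSum261DefiniteFaces.rowConst261_nonneg geo _)
  exact ⟨thm39Printed_rowConst261Blk_of_rowSum261 𝔬 rd d α α' r δ₀ θ₀ B₀ N a₁ M₁ h35 hα hα1 hα'0 hα'1.le hr hrδ hθ₀ hB₀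
      hN ha₁ hM₁ hst hloc hrow h39,
    rwKernelSumYields_EK39OfOpsBlk 𝔬 rd Cinv d hB₁ hδ₁ hcR (fun i y => (hst i).lenpos y) hrd⟩

/-- **PIN FORM**: for expansion data `EK i` EQUAL to the definite carrier datum (the knit's literal pin), rows 15 ∧ 16 about `EK`.
[cite: Balaban1985BackgroundPropagators, Thm 3.9 (3.98)–(3.99) p.413 + Thm 3.2 (3.48) p.398] -/
theorem thm39_and_kernelSum_of_pin_rowConst261Blk (𝔬 : ∀ i, Ops39Blk (geo i) (bg i) (X i) (ι i) (κ i))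
    (rd : ∀ i, WalkReading39 (bg i) (ι i) (κ i)) (Cinv : ∀ i, B9.SiteKernel (geo i) (bg i)) (d : ℕ)
    (α α' r δ₀ θ₀ B₀ N a₁ M₁ cR : ℝ)
    (h35 : 0 < c35) (hα : 0 < α) (hα1 : α < 1) (hα'0 : 0 < α') (hα'1 : α' < 1) (hr : 0 < r) (hrδ : r ≤ δ₀)
    (hθ₀ : 0 ≤ θ₀) (hB₀ : 0 < B₀) (hN : 0 ≤ N) (ha₁ : 0 < a₁) (hM₁ : 0 < M₁) (hcR : 0 ≤ cR)
    (hst : ∀ i, StaticOK39Blk (𝔬 i) N) (hloc : ∀ i, Locality39Blk (𝔬 i) (rd i)) (hrow : B9Ineq349Whole.RowSum261 geo)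
    (hrd : ∀ i, KerReadsLe (𝔬 i) (Cinv i) d cR)
    (h39 : ∀ i, M₁ ≤ (geo i).M → ∀ α₀ : ℝ, 0 < α₀ → c35 * (geo i).M * α₀ ≤ a₁ →
      ∀ U : (bg i).Cfg, (bg i).Reg335 c35 α₀ U →
        Local348Blk (𝔬 i) B₀ δ₀ U ∧ Identities395Blk (𝔬 i) U ∧ Small285Blk (𝔬 i) θ₀ r U ∧ Factors389Blk (𝔬 i) θ₀ δ₀ U)
    {EK : ∀ i, B9.RWKernelExpansion (geo i) (bg i)}
    (hEK : ∀ i, EK i = EK39OfOpsBlk (𝔬 i) (rd i) d (2 * (N * B₀) * B9RowSum261DefiniteFaces.rowConst261 geo (α' * r))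
      ((1 - α') * r)) :
    B9.Thm39Printed d c35 geo bg EK ∧ B9.RWKernelSumYields d geo bg EK Cinv := by
  obtain rfl : EK = fun i => EK39OfOpsBlk (𝔬 i) (rd i) d (2 * (N * B₀) * B9RowSum261DefiniteFaces.rowConst261 geo (α' * r))
      ((1 - α') * r) := funext hEK
  exact thm39_and_kernelSum_rowConst261Blk_of_rowSum261 𝔬 rd Cinv d α α' r δ₀ θ₀ B₀ N a₁ M₁ cR h35 hα hα1 hα'0 hα'1 hr hrδ
    hθ₀ hB₀ hN ha₁ hM₁ hcR hst hloc hrow hrd h39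

/-- **THEOREM 3.2 AS TYPED at the pinned definite carrier datum** (p. 413: *"This theorem implies Theorem 3.2"*).
[cite: Balaban1985BackgroundPropagators, Thm 3.9 ⇒ Thm 3.2 p.413 + Thm 3.2 (3.48) p.398] -/
theorem thm32Printed_of_pin_rowConst261Blk (𝔬 : ∀ i, Ops39Blk (geo i) (bg i) (X i) (ι i) (κ i))
    (rd : ∀ i, WalkReading39 (bg i) (ι i) (κ i)) (Cinv : ∀ i, B9.SiteKernel (geo i) (bg i)) (d : ℕ)
    (α α' r δ₀ θ₀ B₀ N a₁ M₁ cR : ℝ)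
    (h35 : 0 < c35) (hα : 0 < α) (hα1 : α < 1) (hα'0 : 0 < α') (hα'1 : α' < 1) (hr : 0 < r) (hrδ : r ≤ δ₀)
    (hθ₀ : 0 ≤ θ₀) (hB₀ : 0 < B₀) (hN : 0 ≤ N) (ha₁ : 0 < a₁) (hM₁ : 0 < M₁) (hcR : 0 ≤ cR)
    (hst : ∀ i, StaticOK39Blk (𝔬 i) N) (hloc : ∀ i, Locality39Blk (𝔬 i) (rd i)) (hrow : B9Ineq349Whole.RowSum261 geo)
    (hrd : ∀ i, KerReadsLe (𝔬 i) (Cinv i) d cR)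
    (h39 : ∀ i, M₁ ≤ (geo i).M → ∀ α₀ : ℝ, 0 < α₀ → c35 * (geo i).M * α₀ ≤ a₁ →
      ∀ U : (bg i).Cfg, (bg i).Reg335 c35 α₀ U →
        Local348Blk (𝔬 i) B₀ δ₀ U ∧ Identities395Blk (𝔬 i) U ∧ Small285Blk (𝔬 i) θ₀ r U ∧ Factors389Blk (𝔬 i) θ₀ δ₀ U)
    {EK : ∀ i, B9.RWKernelExpansion (geo i) (bg i)}
    (hEK : ∀ i, EK i = EK39OfOpsBlk (𝔬 i) (rd i) d (2 * (N * B₀) * B9RowSum261DefiniteFaces.rowConst261 geo (α' * r))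
      ((1 - α') * r)) :
    B9.Thm32Printed d c35 geo bg Cinv := by
  obtain ⟨h39P, hks⟩ := thm39_and_kernelSum_of_pin_rowConst261Blk 𝔬 rd Cinv d α α' r δ₀ θ₀ B₀ N a₁ M₁ cR h35 hα hα1
    hα'0 hα'1 hr hrδ hθ₀ hB₀ hN ha₁ hM₁ hcR hst hloc hrow hrd h39 hEK
  exact B9.thm32_of_thm39 d c35 geo bg _ Cinv h39P hks

end Rows1516

/-! ## §5 At def-Y's operator-layer signature over the members of record: rows 15 ∧ 16 from the LITERAL carrier pin, ZERO Lemma-2.1 binders -/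

section StageY

open B9PinMembersKLevelV1 B9PinCarriersKLevelV1 B9GeoLemma21KLevelV1

variable {d ℓ : ℕ} {hd : 1 ≤ d + 1} {hL : Odd (ℓ + 1) ∧ 1 < ℓ + 1} {b₀ b₁ : ℝ} {Mstar : ℕ}
variable {𝔸 : Type} [NormedRing 𝔸] [NormedAlgebra ℂ 𝔸] [CompleteSpace 𝔸] {G : Subgroup 𝔸ˣ}
variable (ops : ∀ x : MemberY d ℓ hd hL b₀ b₁ Mstar, OperatorLayerY d ℓ hd hL b₀ b₁ Mstar 𝔸 G x)
variable [∀ x : MemberY d ℓ hd hL b₀ b₁ Mstar, Fintype (geo9Y x).Site]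
  [∀ x : MemberY d ℓ hd hL b₀ b₁ Mstar, DecidableEq (geo9Y x).Site]
variable {c35 : ℝ} {X39 ι κ : MemberY d ℓ hd hL b₀ b₁ Mstar → Type} [∀ x, Fintype (ι x)] [∀ x, Fintype (X39 x)]
  [∀ x, DecidableEq (X39 x)]

/-- ★★ **ROWS 15 ∧ 16 OF THE N06 KNIT FROM THE LITERAL CARRIER PIN AT THE DEFINITE CONSTANT, NO (2.61) BINDER** (the carrier twin of
`B9RowSum261DefiniteFaces.t39_hksum_of_pin_rowConst261`, drop-in for n06-d's `…ObligationsPins2.t39_of_pin` + `hksum_of_pin`): over def-Y's operator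
layer `ops`, for Theorem-3.9 carrier letters `𝔬39 x : Ops39Blk (geo9Y x) (bg9Y 𝔸 G x) (X39 x) (ι x) (κ x)` read by `rd39`, the pin
`(ops x).EK39 = EK39OfOpsBlk (𝔬39 x) (rd39 x) dd (2(N·B₀)·rowConst261 geo9Y (α′r)) ((1−α′)r)` and a carrier kernel `(ops x).Cinv` DOMINATED by the inverse
(`KerReadsLe … cR` — the shape def-Y's reading `sup_{|E| ≤ 1} ‖(C(U)(δ_{y′} ⊗ E))(y)‖` can meet at a non-abelian letter) give `B9.Thm39Printed dd c35 geo9Y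
(bg9Y 𝔸 G) (fun x => (ops x).EK39)` ∧ `B9.RWKernelSumYields dd geo9Y (bg9Y 𝔸 G) (fun x => (ops x).EK39) (fun x => (ops x).Cinv)`; [4] (2.61) at both rates
is n06-i's `rowSum261_geo9Y` BY NAME. [cite: Balaban1985BackgroundPropagators, Thm 3.9 (3.98)–(3.99) p.413 + Thm 3.2 (3.48) p.398 + p.395; Balaban1984PropagatorsII, Lemma 2.1 (2.61) p.234] -/
theorem t39_hksum_of_pin_rowConst261Blk
    (𝔬39 : ∀ x : MemberY d ℓ hd hL b₀ b₁ Mstar, Ops39Blk (geo9Y x) (bg9Y 𝔸 G x) (X39 x) (ι x) (κ x))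
    (rd39 : ∀ x : MemberY d ℓ hd hL b₀ b₁ Mstar, WalkReading39 (bg9Y 𝔸 G x) (ι x) (κ x))
    (dd : ℕ) (α α' r δ₀ θ₀ B₀ N a₁ M₁ cR : ℝ)
    (h35 : 0 < c35) (hα : 0 < α) (hα1 : α < 1) (hα'0 : 0 < α') (hα'1 : α' < 1) (hr : 0 < r) (hrδ : r ≤ δ₀)
    (hθ₀ : 0 ≤ θ₀) (hB₀ : 0 < B₀) (hN : 0 ≤ N) (ha₁ : 0 < a₁) (hM₁ : 0 < M₁) (hcR : 0 ≤ cR)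
    (hst : ∀ x, StaticOK39Blk (𝔬39 x) N) (hloc : ∀ x, Locality39Blk (𝔬39 x) (rd39 x))
    (h39 : ∀ x : MemberY d ℓ hd hL b₀ b₁ Mstar, M₁ ≤ (geo9Y x).M → ∀ α₀ : ℝ, 0 < α₀ → c35 * (geo9Y x).M * α₀ ≤ a₁ →
      ∀ U : (bg9Y 𝔸 G x).Cfg, (bg9Y 𝔸 G x).Reg335 c35 α₀ U →
        Local348Blk (𝔬39 x) B₀ δ₀ U ∧ Identities395Blk (𝔬39 x) U ∧ Small285Blk (𝔬39 x) θ₀ r U ∧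
          Factors389Blk (𝔬39 x) θ₀ δ₀ U)
    (hEK39 : ∀ x : MemberY d ℓ hd hL b₀ b₁ Mstar, (ops x).EK39 =
      EK39OfOpsBlk (𝔬39 x) (rd39 x) dd
        (2 * (N * B₀) * B9RowSum261DefiniteFaces.rowConst261
          (geo9Y (d := d) (ℓ := ℓ) (hd := hd) (hL := hL) (b₀ := b₀) (b₁ := b₁) (Mstar := Mstar)) (α' * r)) ((1 - α') * r))
    (hrdC : ∀ x : MemberY d ℓ hd hL b₀ b₁ Mstar, KerReadsLe (𝔬39 x) (ops x).Cinv dd cR) :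
    B9.Thm39Printed dd c35 geo9Y (bg9Y 𝔸 G) (fun x => (ops x).EK39) ∧
      B9.RWKernelSumYields dd geo9Y (bg9Y 𝔸 G) (fun x => (ops x).EK39) (fun x => (ops x).Cinv) :=
  thm39_and_kernelSum_of_pin_rowConst261Blk 𝔬39 rd39 (fun x => (ops x).Cinv) dd α α' r δ₀ θ₀ B₀ N a₁ M₁ cR h35 hα hα1 hα'0
    hα'1 hr hrδ hθ₀ hB₀ hN ha₁ hM₁ hcR hst hloc rowSum261_geo9Y hrdC h39 hEK39

/-- **THE RECORD COROLLARY WITH THE EXPLICIT CARRIER DATUM** (for an END consumer choosing the expansion letter `𝔈.EK39` itself): rows 15 ∧ 16 at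
`EK39OfOpsBlk (𝔬39 x) (rd39 x) dd (2(N·B₀)·rowConst261 geo9Y (α′r)) ((1−α′)r)` on def-Y's members, (2.61) by `rowSum261_geo9Y`.
[cite: Balaban1985BackgroundPropagators, Thm 3.9 (3.98)–(3.99) p.413 + Thm 3.2 (3.48) p.398; Balaban1984PropagatorsII, Lemma 2.1 (2.61) p.234] -/
theorem thm39_and_kernelSum_geo9Y_blk
    (𝔬39 : ∀ x : MemberY d ℓ hd hL b₀ b₁ Mstar, Ops39Blk (geo9Y x) (bg9Y 𝔸 G x) (X39 x) (ι x) (κ x))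
    (rd39 : ∀ x : MemberY d ℓ hd hL b₀ b₁ Mstar, WalkReading39 (bg9Y 𝔸 G x) (ι x) (κ x))
    (Cinv : ∀ x : MemberY d ℓ hd hL b₀ b₁ Mstar, B9.SiteKernel (geo9Y x) (bg9Y 𝔸 G x))
    (dd : ℕ) (α α' r δ₀ θ₀ B₀ N a₁ M₁ cR : ℝ)
    (h35 : 0 < c35) (hα : 0 < α) (hα1 : α < 1) (hα'0 : 0 < α') (hα'1 : α' < 1) (hr : 0 < r) (hrδ : r ≤ δ₀)
    (hθ₀ : 0 ≤ θ₀) (hB₀ : 0 < B₀) (hN : 0 ≤ N) (ha₁ : 0 < a₁) (hM₁ : 0 < M₁) (hcR : 0 ≤ cR)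
    (hst : ∀ x, StaticOK39Blk (𝔬39 x) N) (hloc : ∀ x, Locality39Blk (𝔬39 x) (rd39 x))
    (hrd : ∀ x, KerReadsLe (𝔬39 x) (Cinv x) dd cR)
    (h39 : ∀ x : MemberY d ℓ hd hL b₀ b₁ Mstar, M₁ ≤ (geo9Y x).M → ∀ α₀ : ℝ, 0 < α₀ → c35 * (geo9Y x).M * α₀ ≤ a₁ →
      ∀ U : (bg9Y 𝔸 G x).Cfg, (bg9Y 𝔸 G x).Reg335 c35 α₀ U →
        Local348Blk (𝔬39 x) B₀ δ₀ U ∧ Identities395Blk (𝔬39 x) U ∧ Small285Blk (𝔬39 x) θ₀ r U ∧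
          Factors389Blk (𝔬39 x) θ₀ δ₀ U) :
    B9.Thm39Printed dd c35 geo9Y (bg9Y 𝔸 G)
        (fun x => EK39OfOpsBlk (𝔬39 x) (rd39 x) dd
          (2 * (N * B₀) * B9RowSum261DefiniteFaces.rowConst261
            (geo9Y (d := d) (ℓ := ℓ) (hd := hd) (hL := hL) (b₀ := b₀) (b₁ := b₁) (Mstar := Mstar)) (α' * r))
          ((1 - α') * r)) ∧
      B9.RWKernelSumYields dd geo9Y (bg9Y 𝔸 G)
        (fun x => EK39OfOpsBlk (𝔬39 x) (rd39 x) dd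
          (2 * (N * B₀) * B9RowSum261DefiniteFaces.rowConst261
            (geo9Y (d := d) (ℓ := ℓ) (hd := hd) (hL := hL) (b₀ := b₀) (b₁ := b₁) (Mstar := Mstar)) (α' * r))
          ((1 - α') * r)) Cinv :=
  thm39_and_kernelSum_rowConst261Blk_of_rowSum261 𝔬39 rd39 Cinv dd α α' r δ₀ θ₀ B₀ N a₁ M₁ cR h35 hα hα1 hα'0 hα'1 hr
    hrδ hθ₀ hB₀ hN ha₁ hM₁ hcR hst hloc rowSum261_geo9Y hrd h39

end StageY

end

end Literature.MathematicalPhysics.QuantumFieldTheory.Balaban1983to89.B9Thm39WholeBlkFaces
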